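import Literature.AnabelianGeometry.SemiGraphs.PSCRamificationCyclicProofs
import HarnessLib

/-!
# Double cosets of an intermediate subgroup: the fibres of `M \ Π / K → B \ Π / K`

Group theory behind the RELATIVE form of [IUTchI] Remark 1.2.3 (iii) (Mochizuki, *Inter-universal
Teichmüller theory I*, p. 41: "`G' → G''` … is cuspidally totally ramified if and only if
`r(G''₁) < l · r(G'')`", used in Remark 1.2.3 (iv) p. 42 for the coverings `G' → G''` attached to
`Π_{G'} = U ⊆ Π_{G''} = A · U`), i.e. of [CombGC] Rmk. 1.4.2 applied to a covering OF A COVERING: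
for subgroups `M ≤ B` of a group `Π` with `B` normalising `M`, and any `K ≤ Π`, the map
`M \ Π / K → B \ Π / K` has, over the double coset of `x`, a fibre in bijection with
`B / (M · (B ∩ x K x⁻¹))` (the `M`-double cosets inside `B x K` are the `M b x K`, `b ∈ B`, and
`M b x K = M b' x K` iff `b⁻¹ b' ∈ M · (B ∩ x K x⁻¹)`).  Consequences (all for `B` of finite index,
`[B : M]` finite):

* `card_doubleCoset_quotient_le_relIndex_mul` — `#(M \ Π / K) ≤ [B : M] · #(B \ Π / K)`;
* `card_doubleCoset_quotient_add_le_relIndex_mul` — if some `M · (B ∩ x₀ K x₀⁻¹) = B` (the cusp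
  `B x₀ K` of `G_B` is totally ramified in `G_M → G_B`), then
  `#(M \ Π / K) + ([B : M] − 1) ≤ [B : M] · #(B \ Π / K)`;
* `card_doubleCoset_quotient_eq_relIndex_mul` — if every `B ∩ x K x⁻¹ ≤ M`, then
  `#(M \ Π / K) = [B : M] · #(B \ Π / K)`.

In `PSCDatum` language (cusps of `G_H` over the cusp `c` = `H \ Π_G / Π_c`, [CombGC] Def. 1.1
(ii) p. 6) these are the three counting facts the printed "one verifies immediately" consists of.
Pure group theory over Mathlib; no definitions. [cite: Mochizuki2012, IUTchI Rmk 1.2.3(iii) p.41]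
-/

namespace Literature.AnabelianGeometry.SemiGraphs

namespace PSCCounting

open scoped Pointwise commutatorElement

variable {P : Type*} [Group P]

/-! ### The refinement `M \ Π / K → B \ Π / K` and its fibres -/

section Fibre

variable {M B : Subgroup P} (K : Subgroup P)

/-- For `M ≤ B` the double-coset relation of `M \ Π / K` refines that of `B \ Π / K`.
[cite: MochizukiCombGC2007, Def 1.1(ii) p.6] -/
theorem doubleCoset_rel_mono (hMB : M ≤ B) {x y : P}
    (h : DoubleCoset.setoid (M : Set P) (K : Set P) x y) :
    DoubleCoset.setoid (B : Set P) (K : Set P) x y := by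
  rw [DoubleCoset.rel_iff] at h ⊢
  obtain ⟨a, ha, b, hb, rfl⟩ := h
  exact ⟨a, hMB ha, b, hb, rfl⟩

/-- `B` normalises every intermediate `M` with `[B, B] ≤ M ≤ B` (the intermediate coverings of a
cyclic covering are Galois over the base). [cite: MochizukiCombGC2007, Def 1.1(ii) p.7] -/
theorem le_normalizer_of_commutator_le (hc : ⁅B, B⁆ ≤ M) (hMB : M ≤ B) :
    B ≤ Subgroup.normalizer (M : Set P) := by
  intro b hb
  rw [Subgroup.mem_normalizer_iff]
  intro m
  constructor
  · intro hm
    have key : ⁅b, m⁆ * m = b * m * b⁻¹ := by rw [commutatorElement_def]; group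
    rw [← key]
    exact M.mul_mem (hc (Subgroup.commutator_mem_commutator hb (hMB hm))) hm
  · intro hm
    have key : ⁅b⁻¹, b * m * b⁻¹⁆ * (b * m * b⁻¹) = m := by rw [commutatorElement_def]; group
    rw [← key]
    exact M.mul_mem (hc (Subgroup.commutator_mem_commutator (B.inv_mem hb) (hMB hm))) hm

/-- **The fibre relation**: for `b, b' ∈ B` (with `M ≤ B ≤ N_Π(M)`), the `M`-double cosets of `b x`
and `b' x` coincide iff `b⁻¹ b' ∈ M · (B ∩ x K x⁻¹)`. [cite: Mochizuki2012, IUTchI Rmk 1.2.3(iii) p.41] -/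
theorem doubleCoset_mk_mul_eq_iff (hMB : M ≤ B) (hBN : B ≤ Subgroup.normalizer (M : Set P))
    {x b b' : P} (hb : b ∈ B) (hb' : b' ∈ B) :
    DoubleCoset.mk M K (b * x) = DoubleCoset.mk M K (b' * x) ↔
      b⁻¹ * b' ∈ M ⊔ (B ⊓ ConjAct.toConjAct x • K) := by
  rw [DoubleCoset.eq]
  constructor
  · rintro ⟨m, hm, k, hk, h⟩
    have hmem : b⁻¹ * b' = (b⁻¹ * m * b) * (x * k * x⁻¹) := by
      calc b⁻¹ * b' = b⁻¹ * (b' * x) * x⁻¹ := by group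
        _ = b⁻¹ * (m * (b * x) * k) * x⁻¹ := by rw [h]
        _ = (b⁻¹ * m * b) * (x * k * x⁻¹) := by group
    have hm' : b⁻¹ * m * b ∈ M := (Subgroup.mem_normalizer_iff''.mp (hBN hb) m).mp hm
    rw [hmem]
    refine Subgroup.mul_mem _ (Subgroup.mem_sup_left hm') (Subgroup.mem_sup_right ?_)
    refine Subgroup.mem_inf.mpr ⟨?_, ?_⟩
    · have : x * k * x⁻¹ = (b⁻¹ * m * b)⁻¹ * (b⁻¹ * b') := by rw [hmem]; group
      rw [this]
      exact B.mul_mem (B.inv_mem (hMB hm')) (B.mul_mem (B.inv_mem hb) hb')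
    · rw [Subgroup.mem_smul_pointwise_iff_exists]
      exact ⟨k, hk, by rw [ConjAct.smul_def, ConjAct.ofConjAct_toConjAct]⟩
  · intro hmem
    have hT : B ⊓ ConjAct.toConjAct x • K ≤ Subgroup.normalizer (M : Set P) :=
      inf_le_left.trans hBN
    have hset := Subgroup.coe_mul_of_right_le_normalizer_left M _ hT
    have hmem' : b⁻¹ * b' ∈ ((M ⊔ (B ⊓ ConjAct.toConjAct x • K) : Subgroup P) : Set P) := hmem
    rw [hset] at hmem'
    obtain ⟨m, hm, t, ht, hmt⟩ := Set.mem_mul.mp hmem'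
    obtain ⟨-, htK⟩ := Subgroup.mem_inf.mp ht
    obtain ⟨k, hk, rfl⟩ := (Subgroup.mem_smul_pointwise_iff_exists _ _ _).mp htK
    refine ⟨b * m * b⁻¹, (Subgroup.mem_normalizer_iff.mp (hBN hb) m).mp hm, k, hk, ?_⟩
    rw [ConjAct.smul_def, ConjAct.ofConjAct_toConjAct] at hmt
    calc b' * x = b * (b⁻¹ * b') * x := by group
      _ = b * (m * (x * k * x⁻¹)) * x := by rw [hmt]
      _ = b * m * b⁻¹ * (b * x) * k := by group

/-- **The fibre of `M \ Π / K → B \ Π / K` over the double coset of `x`** is in bijection with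
`B / (M · (B ∩ x K x⁻¹))`: its cardinality is the relative index `[B : M · (B ∩ x K x⁻¹)]`.
[cite: Mochizuki2012, IUTchI Rmk 1.2.3(iii) p.41] -/
theorem card_fibre_eq_relIndex (hMB : M ≤ B) (hBN : B ≤ Subgroup.normalizer (M : Set P)) (x : P) :
    Nat.card {q : DoubleCoset.Quotient (M : Set P) (K : Set P) //
        Quotient.map' id (fun _ _ h => doubleCoset_rel_mono K hMB h) q = DoubleCoset.mk B K x} =
      (M ⊔ (B ⊓ ConjAct.toConjAct x • K)).relIndex B := by
  set S : Subgroup P := M ⊔ (B ⊓ ConjAct.toConjAct x • K) with hS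
  -- the map `B / (S ∩ B) → fibre`, `b ↦ M b x K`
  have hwd : ∀ b b' : B, QuotientGroup.leftRel (S.subgroupOf B) b b' →
      DoubleCoset.mk M K ((b : P) * x) = DoubleCoset.mk M K ((b' : P) * x) := by
    intro b b' h
    rw [QuotientGroup.leftRel_apply, Subgroup.mem_subgroupOf] at h
    exact (doubleCoset_mk_mul_eq_iff K hMB hBN b.2 b'.2).mpr (by simpa using h)
  have hmem : ∀ b : B, Quotient.map' id (fun _ _ h => doubleCoset_rel_mono K hMB h)
      (DoubleCoset.mk M K ((b : P) * x)) = DoubleCoset.mk B K x := by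
    intro b
    show DoubleCoset.mk B K ((b : P) * x) = DoubleCoset.mk B K x
    rw [DoubleCoset.eq]
    exact ⟨(b : P)⁻¹, B.inv_mem b.2, 1, K.one_mem, by group⟩
  let ψ : B ⧸ S.subgroupOf B →
      {q : DoubleCoset.Quotient (M : Set P) (K : Set P) //
        Quotient.map' id (fun _ _ h => doubleCoset_rel_mono K hMB h) q = DoubleCoset.mk B K x} :=
    Quotient.lift (fun b : B => ⟨DoubleCoset.mk M K ((b : P) * x), hmem b⟩)
      fun b b' h => Subtype.ext (hwd b b' h)
  have hψ : Function.Bijective ψ := by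
    constructor
    · intro q₁ q₂ h
      induction q₁ using Quotient.inductionOn with
      | h b =>
        induction q₂ using Quotient.inductionOn with
        | h b' =>
          apply Quotient.sound
          change (QuotientGroup.leftRel (S.subgroupOf B)) b b'
          rw [QuotientGroup.leftRel_apply, Subgroup.mem_subgroupOf]
          have h' := congrArg Subtype.val h
          simpa using (doubleCoset_mk_mul_eq_iff K hMB hBN b.2 b'.2).mp h'
    · rintro ⟨q, hq⟩
      induction q using Quotient.inductionOn with
      | h y =>
        have hq' : DoubleCoset.mk B K y = DoubleCoset.mk B K x := hq
        rw [DoubleCoset.eq] at hq'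
        obtain ⟨b, hb, k, hk, hxy⟩ := hq'
        refine ⟨Quotient.mk _ ⟨b⁻¹, B.inv_mem hb⟩, Subtype.ext ?_⟩
        show DoubleCoset.mk M K (b⁻¹ * x) = DoubleCoset.mk M K y
        rw [DoubleCoset.eq]
        exact ⟨1, M.one_mem, k⁻¹, K.inv_mem hk, by rw [hxy]; group⟩
  rw [← Nat.card_eq_of_bijective ψ hψ]
  rfl

end Fibre

/-! ### Counting `M \ Π / K` against `B \ Π / K` -/

section Count

variable {M B : Subgroup P} (K : Subgroup P)

/-- For `B` of finite index, `B \ Π / K` is finite. [cite: MochizukiCombGC2007, Def 1.1(ii) p.6] -/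
theorem finite_doubleCoset_quotient (B K : Subgroup P) [B.FiniteIndex] :
    Finite (DoubleCoset.Quotient (B : Set P) (K : Set P)) := by
  haveI : Finite (Quotient (QuotientGroup.rightRel B)) :=
    Finite.of_equiv _ (QuotientGroup.quotientRightRelEquivQuotientLeftRel B).symm
  refine Finite.of_surjective (α := Quotient (QuotientGroup.rightRel B))
    (Quotient.map' id fun x y hxy => ?_) fun q => ?_
  · rw [QuotientGroup.rightRel_apply] at hxy
    rw [DoubleCoset.rel_iff]
    exact ⟨y * x⁻¹, hxy, 1, K.one_mem, by simp⟩
  · induction q using Quotient.inductionOn with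
    | h x => exact ⟨Quotient.mk'' x, rfl⟩

/-- **The fibre decomposition**: `#(M \ Π / K) = Σ_{D ∈ B \ Π / K} [B : M · (B ∩ x_D K x_D⁻¹)]` for
any choice of representatives `x_D` (here `D.out`), `B` of finite index normalising `M ≥ [B,B]`-wise,
`[B : M]` finite. [cite: Mochizuki2012, IUTchI Rmk 1.2.3(iii) p.41] -/
theorem card_doubleCoset_quotient_eq_sum (hMB : M ≤ B) (hBN : B ≤ Subgroup.normalizer (M : Set P))
    [B.FiniteIndex] (hfin : M.relIndex B ≠ 0)
    [Fintype (DoubleCoset.Quotient (B : Set P) (K : Set P))] :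
    Nat.card (DoubleCoset.Quotient (M : Set P) (K : Set P)) =
      ∑ D : DoubleCoset.Quotient (B : Set P) (K : Set P),
        (M ⊔ (B ⊓ ConjAct.toConjAct D.out • K)).relIndex B := by
  classical
  let π : DoubleCoset.Quotient (M : Set P) (K : Set P) → DoubleCoset.Quotient (B : Set P) (K : Set P) :=
    Quotient.map' id (fun _ _ h => doubleCoset_rel_mono K hMB h)
  have hfib : ∀ D : DoubleCoset.Quotient (B : Set P) (K : Set P),
      Nat.card {q // π q = D} = (M ⊔ (B ⊓ ConjAct.toConjAct D.out • K)).relIndex B := by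
    intro D
    conv_lhs => rw [← DoubleCoset.out_eq' B K D]
    exact card_fibre_eq_relIndex K hMB hBN D.out
  haveI : ∀ D : DoubleCoset.Quotient (B : Set P) (K : Set P), Finite {q // π q = D} := by
    intro D
    apply Nat.finite_of_card_ne_zero
    rw [hfib D]
    intro h0
    exact hfin (Nat.eq_zero_of_zero_dvd (h0 ▸ Subgroup.relIndex_dvd_of_le_left B le_sup_left))
  rw [← Nat.card_congr (Equiv.sigmaFiberEquiv π), Nat.card_sigma]
  exact Finset.sum_congr rfl fun D _ => hfib D

/-- The fibre cardinality does not depend on the representative: over the double coset of `x` it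
is `[B : M · (B ∩ x K x⁻¹)]` for ANY `x` in it. [cite: Mochizuki2012, IUTchI Rmk 1.2.3(iii) p.41] -/
theorem relIndex_sup_out_eq (hMB : M ≤ B) (hBN : B ≤ Subgroup.normalizer (M : Set P)) (x : P) :
    (M ⊔ (B ⊓ ConjAct.toConjAct (DoubleCoset.mk B K x).out • K)).relIndex B =
      (M ⊔ (B ⊓ ConjAct.toConjAct x • K)).relIndex B := by
  rw [← card_fibre_eq_relIndex K hMB hBN x, ← card_fibre_eq_relIndex K hMB hBN (DoubleCoset.mk B K x).out,
    DoubleCoset.out_eq']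

/-- **Upper bound**: `#(M \ Π / K) ≤ [B : M] · #(B \ Π / K)` — over each cusp of `G_B` lie at most
`[B : M]` cusps of `G_M`. [cite: Mochizuki2012, IUTchI Rmk 1.2.3(iii) p.41] -/
theorem card_doubleCoset_quotient_le_relIndex_mul (hMB : M ≤ B)
    (hBN : B ≤ Subgroup.normalizer (M : Set P)) [B.FiniteIndex] (hfin : M.relIndex B ≠ 0) :
    Nat.card (DoubleCoset.Quotient (M : Set P) (K : Set P)) ≤
      M.relIndex B * Nat.card (DoubleCoset.Quotient (B : Set P) (K : Set P)) := by
  classical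
  haveI := finite_doubleCoset_quotient B K
  haveI : Fintype (DoubleCoset.Quotient (B : Set P) (K : Set P)) := Fintype.ofFinite _
  rw [card_doubleCoset_quotient_eq_sum K hMB hBN hfin, Nat.card_eq_fintype_card, mul_comm]
  calc ∑ D : DoubleCoset.Quotient (B : Set P) (K : Set P),
        (M ⊔ (B ⊓ ConjAct.toConjAct D.out • K)).relIndex B
      ≤ ∑ _D : DoubleCoset.Quotient (B : Set P) (K : Set P), M.relIndex B :=
        Finset.sum_le_sum fun D _ => Subgroup.relIndex_le_of_le_left le_sup_left hfin
    _ = Fintype.card (DoubleCoset.Quotient (B : Set P) (K : Set P)) * M.relIndex B := by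
        rw [Finset.sum_const, smul_eq_mul, Finset.card_univ]

/-- **Upper bound with one totally ramified cusp**: if `M · (B ∩ x₀ K x₀⁻¹) = B` for some `x₀`
(over the cusp `B x₀ K` of `G_B` there is exactly one cusp of `G_M`), then
`#(M \ Π / K) + ([B : M] − 1) ≤ [B : M] · #(B \ Π / K)`. [cite: Mochizuki2012, IUTchI Rmk 1.2.3(iii) p.41] -/
theorem card_doubleCoset_quotient_add_le_relIndex_mul (hMB : M ≤ B)
    (hBN : B ≤ Subgroup.normalizer (M : Set P)) [B.FiniteIndex] (hfin : M.relIndex B ≠ 0) {x₀ : P}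
    (hx₀ : M ⊔ (B ⊓ ConjAct.toConjAct x₀ • K) = B) :
    Nat.card (DoubleCoset.Quotient (M : Set P) (K : Set P)) + (M.relIndex B - 1) ≤
      M.relIndex B * Nat.card (DoubleCoset.Quotient (B : Set P) (K : Set P)) := by
  classical
  haveI := finite_doubleCoset_quotient B K
  haveI : Fintype (DoubleCoset.Quotient (B : Set P) (K : Set P)) := Fintype.ofFinite _
  set f : DoubleCoset.Quotient (B : Set P) (K : Set P) → ℕ :=
    fun D => (M ⊔ (B ⊓ ConjAct.toConjAct D.out • K)).relIndex B with hf
  have hone : f (DoubleCoset.mk B K x₀) = 1 := by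
    simp only [hf]
    rw [relIndex_sup_out_eq K hMB hBN x₀, hx₀, Subgroup.relIndex_self]
  have hle : ∀ D, f D ≤ M.relIndex B := fun D => Subgroup.relIndex_le_of_le_left le_sup_left hfin
  rw [card_doubleCoset_quotient_eq_sum K hMB hBN hfin, Nat.card_eq_fintype_card]
  change Finset.univ.sum f + (M.relIndex B - 1) ≤ _
  have hrest := Finset.sum_le_card_nsmul (Finset.univ.erase (DoubleCoset.mk B K x₀)) f
    (M.relIndex B) fun D _ => hle D
  rw [Finset.card_erase_of_mem (Finset.mem_univ _), smul_eq_mul, Finset.card_univ] at hrest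
  have hcard : 1 ≤ Fintype.card (DoubleCoset.Quotient (B : Set P) (K : Set P)) :=
    Fintype.card_pos_iff.mpr ⟨DoubleCoset.mk B K x₀⟩
  have hm : 1 ≤ M.relIndex B := Nat.one_le_iff_ne_zero.mpr hfin
  have key : (Fintype.card (DoubleCoset.Quotient (B : Set P) (K : Set P)) - 1) * M.relIndex B +
      M.relIndex B = M.relIndex B * Fintype.card (DoubleCoset.Quotient (B : Set P) (K : Set P)) := by
    zify [hcard, hm]
    ring
  have hsum : f (DoubleCoset.mk B K x₀) + (Finset.univ.erase (DoubleCoset.mk B K x₀)).sum f ≤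
      1 + (Fintype.card (DoubleCoset.Quotient (B : Set P) (K : Set P)) - 1) * M.relIndex B := by
    rw [hone]
    exact Nat.add_le_add_left hrest 1
  rw [Finset.add_sum_erase Finset.univ f (Finset.mem_univ (DoubleCoset.mk B K x₀))] at hsum
  have hsum' : Finset.univ.sum f ≤
      1 + (Fintype.card (DoubleCoset.Quotient (B : Set P) (K : Set P)) - 1) * M.relIndex B := hsum
  clear hsum hrest
  omega

/-- **Exact count when no cusp ramifies**: if every `B ∩ x K x⁻¹ ≤ M`, then
`#(M \ Π / K) = [B : M] · #(B \ Π / K)`. [cite: Mochizuki2012, IUTchI Rmk 1.2.3(iii) p.41] -/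
theorem card_doubleCoset_quotient_eq_relIndex_mul (hMB : M ≤ B)
    (hBN : B ≤ Subgroup.normalizer (M : Set P)) [B.FiniteIndex] (hfin : M.relIndex B ≠ 0)
    (h : ∀ x : P, B ⊓ ConjAct.toConjAct x • K ≤ M) :
    Nat.card (DoubleCoset.Quotient (M : Set P) (K : Set P)) =
      M.relIndex B * Nat.card (DoubleCoset.Quotient (B : Set P) (K : Set P)) := by
  classical
  haveI := finite_doubleCoset_quotient B K
  haveI : Fintype (DoubleCoset.Quotient (B : Set P) (K : Set P)) := Fintype.ofFinite _
  rw [card_doubleCoset_quotient_eq_sum K hMB hBN hfin, Nat.card_eq_fintype_card, mul_comm,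
    Finset.sum_congr rfl fun D _ => by rw [sup_of_le_left (h D.out)], Finset.sum_const, smul_eq_mul,
    Finset.card_univ]

end Count

end PSCCounting

/-! ### [IUTchI] Remark 1.2.3 (iii), RELATIVE form: the cyclic cuspidal criterion for `G' → G''` -/

namespace PSCDatum

open scoped Pointwise

universe u

variable {P : Type u} [Group P] [TopologicalSpace P] (G : PSCDatum P)

/-- **[IUTchI] Remark 1.2.3 (iii), relative form** (p. 41: "if … the covering `G' → G` is cyclic,
then `G' → G` is cuspidally totally ramified if and only if the inequality `r(G'') < l · r(G)` …
is satisfied", applied — as Remark 1.2.3 (iv) p. 42 does — to the cyclic covering `G' → G''` of a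
COVERING `G''` of `G`, `Π_{G'} = U ⊴ Π_{G''} = B`): for `Σ = {l}`, `U` normal in `Π_G`, `B` of
finite index, `B / U` cyclic of order `l ^ k` (`0 < k`), the covering `G_U → G_B` is cuspidally
totally ramified iff for the intermediate covering `G_M → G_B` of degree `l` one has
`r(G_M) < l · r(G_B)`.  PROVED for every datum (the case `B = Π_G` is
`cyclicCuspidallyTotallyRamifiedIff`, abc-iut-L3-t4). [cite: Mochizuki2012, IUTchI Rmk 1.2.3(iii) p.41] -/
theorem isCuspidallyTotallyRamified_iff_cuspCount_lt {l k : ℕ} (hS : G.Sigma = {l}) (hk : 0 < k)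
    {B U : Subgroup P} [U.Normal] [B.FiniteIndex] (hcyc : IsCyclicCovering B U)
    (hidx : U.relIndex B = l ^ k) :
    G.IsCuspidallyTotallyRamified B U ↔
      ∀ M : Subgroup P, U ≤ M → M ≤ B → M.relIndex B = l →
        G.cuspCount M < l * G.cuspCount B := by
  have hl := G.prime_of_sigma_eq hS
  obtain ⟨hGal, g, -, hgen⟩ := hcyc
  have hcomm : ⁅B, B⁆ ≤ U := PSCCounting.commutator_le_of_sup_zpowers_eq U B hgen
  have hL : G.IsCuspidallyTotallyRamified B U ↔
      ∃ (c : G.graph.C) (γ : ConjAct P), (B ⊓ γ • G.cuspGp c) ⊔ U = B := by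
    unfold IsCuspidallyTotallyRamified
    rw [and_iff_right hGal]
  rw [hL]
  constructor
  · rintro ⟨c, γ, hc⟩ M hUM hMB hMidx
    have hBN : B ≤ Subgroup.normalizer (M : Set P) :=
      PSCCounting.le_normalizer_of_commutator_le (hcomm.trans hUM) hMB
    have hfin : M.relIndex B ≠ 0 := by rw [hMidx]; exact hl.ne_zero
    have hx₀ : M ⊔ (B ⊓ ConjAct.toConjAct (ConjAct.ofConjAct γ) • G.cuspGp c) = B := by
      rw [ConjAct.toConjAct_ofConjAct]
      refine le_antisymm (sup_le hMB inf_le_left) ?_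
      calc B = (B ⊓ γ • G.cuspGp c) ⊔ U := hc.symm
        _ ≤ (B ⊓ γ • G.cuspGp c) ⊔ M := sup_le_sup_left hUM _
        _ = M ⊔ (B ⊓ γ • G.cuspGp c) := sup_comm _ _
    have h₀ := PSCCounting.card_doubleCoset_quotient_add_le_relIndex_mul (G.cuspGp c) hMB hBN hfin hx₀
    have h₁ : ∀ c', Nat.card (DoubleCoset.Quotient (M : Set P) (G.cuspGp c' : Set P)) ≤
        l * Nat.card (DoubleCoset.Quotient (B : Set P) (G.cuspGp c' : Set P)) := fun c' =>
      hMidx ▸ PSCCounting.card_doubleCoset_quotient_le_relIndex_mul (G.cuspGp c') hMB hBN hfin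
    rw [hMidx] at h₀
    unfold cuspCount
    rw [Finset.mul_sum, ← Finset.add_sum_erase _ _ (Finset.mem_univ c),
      ← Finset.add_sum_erase _ (fun c' => l * _) (Finset.mem_univ c)]
    have hrest : ∑ c' ∈ Finset.univ.erase c,
        Nat.card (DoubleCoset.Quotient (M : Set P) (G.cuspGp c' : Set P)) ≤
        ∑ c' ∈ Finset.univ.erase c, l * Nat.card (DoubleCoset.Quotient (B : Set P) (G.cuspGp c' : Set P)) :=
      Finset.sum_le_sum fun c' _ => h₁ c'
    have h2 := hl.two_le
    omega
  · intro h
    by_contra hnone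
    push Not at hnone
    obtain ⟨M, hUM, hMB, -, hMidx, hfrat⟩ :=
      PSCCounting.exists_frattini_of_cyclic_quotient U B hgen hl hk hidx
    have hBN : B ≤ Subgroup.normalizer (M : Set P) :=
      PSCCounting.le_normalizer_of_commutator_le (hcomm.trans hUM) hMB
    have hfin : M.relIndex B ≠ 0 := by rw [hMidx]; exact hl.ne_zero
    have hall : ∀ (c : G.graph.C) (x : P), B ⊓ ConjAct.toConjAct x • G.cuspGp c ≤ M := by
      intro c x
      by_contra hE
      exact hnone c (ConjAct.toConjAct x) (by rw [sup_comm]; exact (hfrat _ inf_le_left).mpr hE)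
    have hM := h M hUM hMB hMidx
    have heq : G.cuspCount M = l * G.cuspCount B := by
      unfold cuspCount
      rw [Finset.mul_sum]
      exact Finset.sum_congr rfl fun c _ => by
        rw [PSCCounting.card_doubleCoset_quotient_eq_relIndex_mul (G.cuspGp c) hMB hBN hfin (hall c),
          hMidx]
    omega

end PSCDatum

end Literature.AnabelianGeometry.SemiGraphs
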